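import Summits.ResolutionOfSingularities.ResolutionOfSingularities.Theorems.DirectrixCutCells
import Summits.ResolutionOfSingularities.ResolutionOfSingularities.Theorems.CouplingMapRoot
import HarnessLib

/-! # DirectrixCutRoot — decomp-res-lens-4 g41 node «DirectrixCut», FILE C (§143: the root consumers of the landed
`noForcedTowers_of_g40b` (Theorems/CouplingMapRoot, 16 binders) RE-TYPED to the new located core — `hcore` ONLY, every other binder
verbatim: `ftt_step_of_g41`, `forcedTowersTerminate_of_g41`, `noForcedTowers_of_g41`, `noForcedTowers_of_g41_residual`).  VERBATIM slice of
HOME/decomp-res-lens-4/g41/DirectrixCut.lean. -/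


noncomputable section

open CategoryTheory AlgebraicGeometry IsLocalRing TopologicalSpace
open Literature.AlgebraicGeometry.Resolution
open Summit.ResolutionOfSingularities.ResolutionOfSingularities.Theses
open Summit.ResolutionOfSingularities.ResolutionOfSingularities.Theorems
open WeakOrderReduction ForcedTowerClasses DivergentTowerClasses MonomialTowerClasses
open HugDimensionClasses HugDimensionKernels SurfaceShadowClasses SurfaceShadowKernels
open NearPointCut (SingularClass)
open Scheme.IdealSheafData (vanishingIdeal)

universe u

namespace Summit.ResolutionOfSingularities.ResolutionOfSingularities.Theorems.HugValuationCut

/-! ## ══ FILE C `Theorems/DirectrixCutRoot.lean` (§143; imports FILE B `DirectrixCutCells` and the LANDED `CouplingMapRoot`) ══ -/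

section DirectrixRoot

/-! ## §143 (g41 · ROOT) THE ROOT CONSUMERS RE-TYPED TO THE NEW LOCATED CORE — `hcore` ONLY, EVERY OTHER BINDER VERBATIM -/

/-- **the weight-`n` step from the g41 cells**: g40b's `ftt_step_of_g40b` with the core cell `hK` re-typed to C₃♮ʳᶠ♯ᵏ♯ᵉ (re-location
`…_iff_g41`, hypothesis-free) and nothing else changed. [folklore] -/
theorem ftt_step_of_g41 {n : ℕ} (hn : 1 ≤ n) (hMo : MonomialCorner n) (hC : CurveLaw n) (hSL : SurfaceLaw n)
    (hH : HypersurfaceHuggingTowersTerminate n) (hP : ShadowPort n) (hM : MarkingPort n)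
    (hRi : RiderPort n) (h71 : ContactHuggingTowersTerminate n) (h640 : SurfaceChainPort)
    (hB : WildLatentFactorNonThreefoldMixedWallFreeFreshJumpShallowCompanionKangarooTowersTerminate n)
    (hK : WildOccultDivisorialThreefoldNonLineRecurrentCompanionCurveFreeBirthRecurrentCofactorBirthRecurrentNarrowCofactorNarrowMixedWallFreeFreshJumpShallowCompanionKangarooTowersTerminate
      n)
    (hC4 : WildOccultDivisorialNonThreefoldMixedWallFreeFreshJumpShallowCompanionKangarooTowersTerminate n)
    (hD4 : WildOccultNonDivisorialNonThreefoldMixedWallFreeFreshJumpShallowCompanionKangarooTowersTerminate n)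
    (hNP : ContactFreeNonPrincipalInLocusTowersTerminate n) (hPu : PurePrincipalTowersTerminate n)
    (hR : IncommensurableWildDriftingImperfectTowersTerminate n)
    (hlow : ∀ n' : ℕ, 1 ≤ n' → n' < n → ForcedTowersTerminate n') : ForcedTowersTerminate n :=
  ftt_step_of_g40b hn hMo hC hSL hH hP hM hRi h71 h640 hB ((wildOccultDivisorialThreefoldNonLineRecurrentCompanionCurveFreeBirthRecurrentCofactorBirthRecurrentMixed_iff_g41 n).mpr hK) hC4 hD4 hNP hPu hR hlow

/-- **`∀ n ≥ 1, ForcedTowersTerminate n` by strong induction on the weight**, `hcore` re-typed to the g41 core. [folklore] -/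
theorem forcedTowersTerminate_of_g41 (hMo : MaxContactCut.MonomialCornerAll) (hC : MaxContactCut.CurveLawAll)
    (hSL : MaxContactCut.SurfaceLawAll) (hH : MaxContactCut.NoHypersurfaceHuggingTowers) (hP : ShadowPortAll)
    (hM : MarkingPortAll) (hRi : RiderPortAll) (h71 : MaxContactCut.NoContactHuggingTowers) (h640 : SurfaceChainPort)
    (hB : NoWildLatentFactorNonThreefoldMixedTowers)
    (hcore : ∀ n : ℕ, 1 ≤ n → MinimalAt n →
      WildOccultDivisorialThreefoldNonLineRecurrentCompanionCurveFreeBirthRecurrentCofactorBirthRecurrentNarrowCofactorNarrowMixedWallFreeFreshJumpShallowCompanionKangarooTowersTerminate n)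
    (hC4 : NoWildOccultDivisorialNonThreefoldMixedTowers) (hD4 : NoWildOccultNonDivisorialNonThreefoldMixedTowers)
    (hNP : NoContactFreeNonPrincipalInLocusTowers) (hPu : NoPurePrincipalTowers) (hR : NoIncommensurableWildDriftingImperfectTowers) :
    ∀ n : ℕ, 1 ≤ n → ForcedTowersTerminate n :=
  forcedTowersTerminate_of_g40b hMo hC hSL hH hP hM hRi h71 h640 hB
    (fun n hn hmin => (wildOccultDivisorialThreefoldNonLineRecurrentCompanionCurveFreeBirthRecurrentCofactorBirthRecurrentMixed_iff_g41 n).mpr (hcore n hn hmin)) hC4 hD4 hNP hPu hR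

/-- **30253 `MaxContactCut.NoForcedTowers` BY NAME from the g41 cells: g40b's root consumer with `hcore` re-typed to the DOUBLY NARROW
core C₃♮ʳᶠ♯ᵏ♯ᵉ (minimal currency) and the other 15 binders verbatim.** [folklore] -/
theorem noForcedTowers_of_g41 (hMo : MaxContactCut.MonomialCornerAll) (hC : MaxContactCut.CurveLawAll)
    (hSL : MaxContactCut.SurfaceLawAll) (hH : MaxContactCut.NoHypersurfaceHuggingTowers) (hP : ShadowPortAll)
    (hM : MarkingPortAll) (hRi : RiderPortAll) (h71 : MaxContactCut.NoContactHuggingTowers) (h640 : SurfaceChainPort)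
    (hB : NoWildLatentFactorNonThreefoldMixedTowers)
    (hcore : ∀ n : ℕ, 1 ≤ n → MinimalAt n →
      WildOccultDivisorialThreefoldNonLineRecurrentCompanionCurveFreeBirthRecurrentCofactorBirthRecurrentNarrowCofactorNarrowMixedWallFreeFreshJumpShallowCompanionKangarooTowersTerminate n)
    (hC4 : NoWildOccultDivisorialNonThreefoldMixedTowers) (hD4 : NoWildOccultNonDivisorialNonThreefoldMixedTowers)
    (hNP : NoContactFreeNonPrincipalInLocusTowers) (hPu : NoPurePrincipalTowers) (hR : NoIncommensurableWildDriftingImperfectTowers) :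
    MaxContactCut.NoForcedTowers :=
  noForcedTowers_of_g40b hMo hC hSL hH hP hM hRi h71 h640 hB
    (fun n hn hmin => (wildOccultDivisorialThreefoldNonLineRecurrentCompanionCurveFreeBirthRecurrentCofactorBirthRecurrentMixed_iff_g41 n).mpr (hcore n hn hmin)) hC4 hD4 hNP hPu hR

/-- the same from the ABSOLUTE g41 located residual by name. [folklore] -/
theorem noForcedTowers_of_g41_residual (hMo : MaxContactCut.MonomialCornerAll) (hC : MaxContactCut.CurveLawAll)
    (hSL : MaxContactCut.SurfaceLawAll) (hH : MaxContactCut.NoHypersurfaceHuggingTowers) (hP : ShadowPortAll)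
    (hM : MarkingPortAll) (hRi : RiderPortAll) (h71 : MaxContactCut.NoContactHuggingTowers) (h640 : SurfaceChainPort)
    (hB : NoWildLatentFactorNonThreefoldMixedTowers)
    (hres : NoWildOccultDoublyNarrowCofactorBirthRecurrentCurveFreeCompanionNonLineMixedTowers)
    (hNP : NoContactFreeNonPrincipalInLocusTowers) (hPu : NoPurePrincipalTowers) (hR : NoIncommensurableWildDriftingImperfectTowers) :
    MaxContactCut.NoForcedTowers :=
  noForcedTowers_of_g40b_residual hMo hC hSL hH hP hM hRi h71 h640 hB
    (noWildOccultCofactorBirthRecurrentCurveFreeCompanionNonLineMixedTowers_of_g41 hres) hNP hPu hR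

end DirectrixRoot

end Summit.ResolutionOfSingularities.ResolutionOfSingularities.Theorems.HugValuationCut
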